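import Literature.Computability.AlgebraicComplexity.AlperBogartVelascoBoxThree
import Literature.Computability.AlgebraicComplexity.StandardFamilies
import Literature.LinearAlgebra.Matrix.PermanentSubperm
import HarnessLib

/-!
# Route `SymPencil` — subspaces along which `per_4` is affine have dimension `≤ 4`
# (the `per_4`-combinatorics of the rung `sdc(per_4) ≥ 18`, `--supports` stmt-ValiantsHypothesis-5674)

Let `W` be a linear subspace of `4 × 4` matrices over a field of characteristic `0` such that

  for every matrix `u` and every `y ∈ W`, `s ↦ per_4 (u + s y)` is affine  (`∃ e₀ e₁, = e₀ + s e₁`).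

Then `dim W ≤ 4` (`finrank_le_four_of_affine`).  Proof:

* at `u₀ = E₂₂ + E₃₃`, `per_4 (u₀ + s y) = s² (y₀₀ y₁₁ + y₀₁ y₁₀) + s³ (…) + s⁴ per y`
  (`Matrix.permanent_fin_four_row`), so affineness kills the `2 × 2` subpermanent
  `y₀₀ y₁₁ + y₀₁ y₁₀`; permuting rows and columns (which preserves `per_4` and the hypothesis),
  EVERY `2 × 2` subpermanent vanishes on `W` (`perm_two_blocks_of_affine`);
* a subspace of `4 × 4` matrices all of whose `2 × 2` subpermanents vanish has dimension `≤ 4`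
  (`finrank_le_four_of_perm_two_blocks`): filter `W` by rows as in
  `AlperBogartVelasco.finrank_le_three_of_subperm_two_vanish` — `dim W = Σ_p dim Y_p`, the
  polarised quadrics pair `Y_p` with `Y_q` (`u_j v_l + u_l v_j = 0`), so a non-zero `Y_q` forces
  `dim Y_p ≤ 1` for all `p ≠ q` (`finrank_le_one_of_pairings`), and four such numbers sum to `≤ 4`.

This is the last step of `sdc(per_4) ≥ 18`: there the subspace `V = ker b` of kernel rows has
dimension `8` and `per_4` is affine along it (`SymPencilLagrangianKernel`). [folklore]
-/

noncomputable section

-- single-conjunct layout: Sub = Summit, duplicated namespace component intended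
set_option linter.dupNamespace false

namespace Summit.ValiantsHypothesis.ValiantsHypothesis.Theorems.SymPencilPerFourBlocks

open Matrix MvPolynomial Finset Module
open Literature.Computability.AlgebraicComplexity
open Literature.Computability.AlgebraicComplexity.AlperBogartVelasco

variable {K : Type*} [Field K]

/-! ### `per_4` near `E₂₂ + E₃₃` -/

/-- `succAbove` values on `Fin 4` used below. [folklore] -/
theorem succAbove_fin_four :
    (2 : Fin 4).succAbove 0 = 0 ∧ (2 : Fin 4).succAbove 1 = 1 ∧ (2 : Fin 4).succAbove 2 = 3 ∧
    (3 : Fin 4).succAbove 0 = 0 ∧ (3 : Fin 4).succAbove 1 = 1 ∧ (3 : Fin 4).succAbove 2 = 2 := by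
  decide

/-- **`per_4 (E₂₂ + E₃₃ + s y)` as a polynomial in `s`**: the coefficient of `s²` is the `2 × 2`
subpermanent `y₀₀ y₁₁ + y₀₁ y₁₀`, there is no constant or linear term. [folklore] -/
theorem eval_perPoly_two_units_add_smul (y : Fin 4 × Fin 4 → K) : ∃ c₃ c₄ : K, ∀ s : K,
    eval ((fun p : Fin 4 × Fin 4 => if p = (2, 2) then (1 : K) else if p = (3, 3) then 1 else 0) +
        s • y) (perPoly (Fin 4) K) =
      s ^ 2 * (y (0, 0) * y (1, 1) + y (0, 1) * y (1, 0)) + s ^ 3 * c₃ + s ^ 4 * c₄ := by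
  obtain ⟨e20, e21, e22, e30, e31, e32⟩ := (succAbove_fin_four : _ ∧ _)
  refine ⟨((Matrix.of fun i j => y (i, j)).submatrix (3 : Fin 4).succAbove (3 : Fin 4).succAbove).permanent +
    ((Matrix.of fun i j => y (i, j)).submatrix (2 : Fin 4).succAbove (2 : Fin 4).succAbove).permanent,
    (Matrix.of fun i j => y (i, j)).permanent, fun s => ?_⟩
  rw [eval_perPoly, Matrix.permanent_fin_four_row, Matrix.permanent_fin_four_row,
    Matrix.permanent_fin_three_row, Matrix.permanent_fin_three_row]
  simp only [Matrix.of_apply, Matrix.submatrix_apply, Pi.add_apply, Pi.smul_apply, smul_eq_mul,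
    e20, e21, e22, e30, e31, e32, Prod.mk.injEq]
  simp only [show ((0 : Fin 4) = 2) = False by decide, show ((1 : Fin 4) = 2) = False by decide,
    show ((3 : Fin 4) = 2) = False by decide, show ((0 : Fin 4) = 3) = False by decide,
    show ((1 : Fin 4) = 3) = False by decide, show ((2 : Fin 4) = 3) = False by decide,
    and_false, and_true, if_false, if_true, and_self]
  ring

/-- From affineness at `E₂₂ + E₃₃`: the `2 × 2` subpermanent on rows/columns `{0,1}` vanishes.
[folklore] -/
theorem perm_two_zero_one_of_affine [CharZero K] (y : Fin 4 × Fin 4 → K)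
    (h : ∃ e₀ e₁ : K, ∀ s : K,
      eval ((fun p : Fin 4 × Fin 4 => if p = (2, 2) then (1 : K) else if p = (3, 3) then 1 else 0) +
        s • y) (perPoly (Fin 4) K) = e₀ + s * e₁) :
    y (0, 0) * y (1, 1) + y (0, 1) * y (1, 0) = 0 := by
  obtain ⟨e₀, e₁, he⟩ := h
  obtain ⟨c₃, c₄, hc⟩ := eval_perPoly_two_units_add_smul y
  set q := y (0, 0) * y (1, 1) + y (0, 1) * y (1, 0) with hq
  have P : ∀ s : K, s ^ 2 * q + s ^ 3 * c₃ + s ^ 4 * c₄ = e₀ + s * e₁ := fun s => by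
    rw [← hc s, he s]
  have h0 := P 0
  have h1 := P 1
  have h1' := P (-1)
  have h2 := P 2
  have h2' := P (-2)
  have h24 : (24 : K) * q = 0 := by linear_combination 16 * (h1 + h1') - (h2 + h2') - 30 * h0
  have h24' : (24 : K) ≠ 0 := by norm_num
  exact (mul_eq_zero.1 h24).resolve_left h24'

/-! ### Permuting rows and columns -/

/-- `per_4` is invariant under permuting rows and columns of the argument. [folklore] -/
theorem eval_perPoly_comp_prodCongr (σ τ : Equiv.Perm (Fin 4)) (z : Fin 4 × Fin 4 → K) :
    eval (z ∘ (Equiv.prodCongr σ τ)) (perPoly (Fin 4) K) = eval z (perPoly (Fin 4) K) := by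
  rw [eval_perPoly, eval_perPoly]
  have h : (Matrix.of fun i j => (z ∘ (Equiv.prodCongr σ τ)) (i, j)) =
      ((Matrix.of fun i j => z (i, j)).submatrix σ id).submatrix id τ := by
    ext i j
    simp
  rw [h, Matrix.permanent_permute_rows, Matrix.permanent_permute_cols]

/-- A permutation of `Fin 4` with prescribed values at `0` and `1`. [folklore] -/
theorem exists_perm_zero_one (i k : Fin 4) (hik : i ≠ k) :
    ∃ σ : Equiv.Perm (Fin 4), σ 0 = i ∧ σ 1 = k := by
  set σ₁ := Equiv.swap (0 : Fin 4) i with hσ₁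
  refine ⟨σ₁ * Equiv.swap (1 : Fin 4) (σ₁ k), ?_, ?_⟩
  · rw [Equiv.Perm.mul_apply]
    have hk' : σ₁ k ≠ 0 := by
      intro h
      have : k = σ₁.symm 0 := by rw [← h, Equiv.symm_apply_apply]
      rw [hσ₁, Equiv.symm_swap, Equiv.swap_apply_left] at this
      exact hik this.symm
    rw [Equiv.swap_apply_of_ne_of_ne (by decide) hk'.symm, hσ₁, Equiv.swap_apply_left]
  · rw [Equiv.Perm.mul_apply, Equiv.swap_apply_left, hσ₁, Equiv.swap_apply_self]

/-- **All `2 × 2` subpermanents vanish on a subspace along which `per_4` is affine.** [folklore] -/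
theorem perm_two_blocks_of_affine [CharZero K] (W : Submodule K (Fin 4 × Fin 4 → K))
    (hW : ∀ (u : Fin 4 × Fin 4 → K), ∀ y ∈ W, ∃ e₀ e₁ : K, ∀ s : K,
      eval (u + s • y) (perPoly (Fin 4) K) = e₀ + s * e₁) :
    ∀ y ∈ W, ∀ i k j l : Fin 4, i ≠ k → j ≠ l →
      y (i, j) * y (k, l) + y (i, l) * y (k, j) = 0 := by
  intro y hy i k j l hik hjl
  obtain ⟨σ, hσ0, hσ1⟩ := exists_perm_zero_one i k hik
  obtain ⟨τ, hτ0, hτ1⟩ := exists_perm_zero_one j l hjl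
  set e := Equiv.prodCongr σ τ with he
  -- the transported matrix `y' = y ∘ e` satisfies the affineness hypothesis
  have h' : ∃ e₀ e₁ : K, ∀ s : K,
      eval ((fun p : Fin 4 × Fin 4 => if p = (2, 2) then (1 : K) else if p = (3, 3) then 1 else 0) +
        s • (y ∘ e)) (perPoly (Fin 4) K) = e₀ + s * e₁ := by
    set u₀ : Fin 4 × Fin 4 → K :=
      fun p => if p = (2, 2) then (1 : K) else if p = (3, 3) then 1 else 0 with hu₀
    obtain ⟨e₀, e₁, h⟩ := hW (u₀ ∘ e.symm) y hy
    refine ⟨e₀, e₁, fun s => ?_⟩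
    have hcomp : u₀ + s • (y ∘ e) = (u₀ ∘ e.symm + s • y) ∘ e := by
      ext p
      simp
    rw [hcomp, he, eval_perPoly_comp_prodCongr, ← he, h s]
  have h2 := perm_two_zero_one_of_affine (y ∘ e) h'
  simp only [Function.comp_apply, he, Equiv.prodCongr_apply, Prod.map_apply, hσ0, hσ1, hτ0,
    hτ1] at h2
  exact h2

/-! ### Subspaces with all `2 × 2` subpermanents vanishing -/

/-- Four numbers `≤ 4` such that a non-zero one forces all OTHERS to be `≤ 1` sum to `≤ 4`.
[folklore] -/
theorem sum_le_four_of_pairs (n : Fin 4 → ℕ) (hle : ∀ i, n i ≤ 4)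
    (hPL : ∀ p q, p ≠ q → 1 ≤ n q → n p ≤ 1) : ∑ i, n i ≤ 4 := by
  rw [Fin.sum_univ_four]
  have h0 := hle 0; have h1 := hle 1; have h2 := hle 2; have h3 := hle 3
  have a01 := hPL 0 1 (by decide); have a02 := hPL 0 2 (by decide); have a03 := hPL 0 3 (by decide)
  have a10 := hPL 1 0 (by decide); have a12 := hPL 1 2 (by decide); have a13 := hPL 1 3 (by decide)
  have a20 := hPL 2 0 (by decide); have a21 := hPL 2 1 (by decide); have a23 := hPL 2 3 (by decide)
  have a30 := hPL 3 0 (by decide); have a31 := hPL 3 1 (by decide); have a32 := hPL 3 2 (by decide)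
  omega

/-- **A subspace of `4 × 4` matrices all of whose `2 × 2` subpermanents vanish has dimension
`≤ 4`** (attained by the matrices supported on one row). [folklore] -/
theorem finrank_le_four_of_perm_two_blocks (W : Submodule K (Fin 4 × Fin 4 → K))
    (hB : ∀ y ∈ W, ∀ i k j l : Fin 4, i ≠ k → j ≠ l →
      y (i, j) * y (k, l) + y (i, l) * y (k, j) = 0) :
    finrank K W ≤ 4 := by
  -- rows as linear maps and the flag
  let ρ : Fin 4 → (Fin 4 × Fin 4 → K) →ₗ[K] (Fin 4 → K) :=
    fun r => LinearMap.funLeft K K fun j => (r, j)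
  have hρ : ∀ r x j, ρ r x j = x (r, j) := fun _ _ _ => rfl
  let V₂ : Submodule K (Fin 4 × Fin 4 → K) := W ⊓ LinearMap.ker (ρ 3)
  let V₁ : Submodule K (Fin 4 × Fin 4 → K) := V₂ ⊓ LinearMap.ker (ρ 2)
  let V₀ : Submodule K (Fin 4 × Fin 4 → K) := V₁ ⊓ LinearMap.ker (ρ 1)
  let V : Fin 4 → Submodule K (Fin 4 × Fin 4 → K) := ![V₀, V₁, V₂, W]
  have hV0 : V 0 = V₀ := rfl
  have hV1 : V 1 = V₁ := rfl
  have hV2 : V 2 = V₂ := rfl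
  have hV3 : V 3 = W := rfl
  -- membership: `x ∈ V p` lies in `W` and has zero rows above `p`
  have memV : ∀ p, ∀ x ∈ V p, x ∈ W ∧ ∀ r, p < r → ∀ j, x (r, j) = 0 := by
    have hcases : ∀ i : Fin 4, i = 0 ∨ i = 1 ∨ i = 2 ∨ i = 3 := by decide
    intro p x hx
    rcases hcases p with rfl | rfl | rfl | rfl
    · rw [hV0] at hx
      simp only [V₀, V₁, V₂, Submodule.mem_inf, LinearMap.mem_ker] at hx
      obtain ⟨⟨⟨hW', h3⟩, h2⟩, h1⟩ := hx
      refine ⟨hW', fun r hr j => ?_⟩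
      rcases hcases r with rfl | rfl | rfl | rfl
      · exact absurd hr (by decide)
      · exact congr_fun h1 j
      · exact congr_fun h2 j
      · exact congr_fun h3 j
    · rw [hV1] at hx
      simp only [V₁, V₂, Submodule.mem_inf, LinearMap.mem_ker] at hx
      obtain ⟨⟨hW', h3⟩, h2⟩ := hx
      refine ⟨hW', fun r hr j => ?_⟩
      rcases hcases r with rfl | rfl | rfl | rfl
      · exact absurd hr (by decide)
      · exact absurd hr (by decide)
      · exact congr_fun h2 j
      · exact congr_fun h3 j
    · rw [hV2] at hx
      simp only [V₂, Submodule.mem_inf, LinearMap.mem_ker] at hx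
      obtain ⟨hW', h3⟩ := hx
      refine ⟨hW', fun r hr j => ?_⟩
      rcases hcases r with rfl | rfl | rfl | rfl
      · exact absurd hr (by decide)
      · exact absurd hr (by decide)
      · exact absurd hr (by decide)
      · exact congr_fun h3 j
    · rw [hV3] at hx
      refine ⟨hx, fun r hr j => ?_⟩
      exact absurd (Fin.le_last r) (not_le.2 hr)
  -- dimension count along the flag
  have hdim : finrank K W = ∑ p, finrank K ((V p).map (ρ p)) := by
    have hbot : (V₀ ⊓ LinearMap.ker (ρ 0) : Submodule K _) = ⊥ := by
      rw [eq_bot_iff]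
      intro x hx
      rw [Submodule.mem_inf, LinearMap.mem_ker] at hx
      obtain ⟨-, hrows⟩ := memV 0 x hx.1
      have h0 : ∀ j, x (0, j) = 0 := fun j => congr_fun hx.2 j
      rw [Submodule.mem_bot]
      funext ⟨i, j⟩
      by_cases hi : i = 0
      · subst hi; exact h0 j
      · exact hrows i (by
          have : (0 : Fin 4) ≤ i := Fin.zero_le i
          exact lt_of_le_of_ne this (Ne.symm hi)) j
    rw [Fin.sum_univ_four, hV0, hV1, hV2, hV3,
      finrank_eq_finrank_map_add_finrank_inf_ker W (ρ 3),
      finrank_eq_finrank_map_add_finrank_inf_ker V₂ (ρ 2),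
      finrank_eq_finrank_map_add_finrank_inf_ker V₁ (ρ 1),
      finrank_eq_finrank_map_add_finrank_inf_ker V₀ (ρ 0), hbot, finrank_bot]
    ring
  -- the pairing between two levels (polarisation of the quadrics)
  have hpair : ∀ (p q : Fin 4) (x x' : Fin 4 × Fin 4 → K), x ∈ W → x' ∈ W →
      (∀ j, x (q, j) = 0) → ∀ j l, j ≠ l → p ≠ q →
      x (p, j) * x' (q, l) + x (p, l) * x' (q, j) = 0 := by
    intro p q x x' hx hx' hxq j l hjl hpq
    have h1 := hB (x + x') (W.add_mem hx hx') p q j l hpq hjl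
    have h2 := hB x' hx' p q j l hpq hjl
    simp only [Pi.add_apply, hxq, zero_add] at h1
    linear_combination h1 - h2
  have hP : ∀ p q, p ≠ q → ∀ u ∈ (V p).map (ρ p), ∀ v ∈ (V q).map (ρ q),
      ∀ j l, j ≠ l → u j * v l + u l * v j = 0 := by
    intro p q hpq u hu v hv j l hjl
    rw [Submodule.mem_map] at hu hv
    obtain ⟨x, hx, rfl⟩ := hu
    obtain ⟨x', hx', rfl⟩ := hv
    obtain ⟨hxW, hxr⟩ := memV p x hx
    obtain ⟨hx'W, hx'r⟩ := memV q x' hx'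
    simp only [hρ]
    rcases lt_or_gt_of_ne hpq with hlt | hgt
    · exact hpair p q x x' hxW hx'W (hxr q hlt) j l hjl hpq
    · have h := hpair q p x' x hx'W hxW (hx'r p hgt) l j hjl.symm hpq.symm
      linear_combination h
  -- the count
  have hle : ∀ i, finrank K ((V i).map (ρ i)) ≤ 4 := fun i =>
    (((V i).map (ρ i)).finrank_le).trans (by rw [finrank_fintype_fun_eq_card, Fintype.card_fin])
  have hPL : ∀ p q, p ≠ q → 1 ≤ finrank K ((V q).map (ρ q)) →
      finrank K ((V p).map (ρ p)) ≤ 1 := by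
    intro p q hpq hq
    have hne : (V q).map (ρ q) ≠ ⊥ := fun h => by
      rw [h, finrank_bot] at hq; exact absurd hq (by decide)
    obtain ⟨v, hv, hv0⟩ := Submodule.exists_mem_ne_zero_of_ne_bot hne
    obtain ⟨c₀, hc₀⟩ : ∃ c₀, v c₀ ≠ 0 := by
      by_contra hall
      push Not at hall
      exact hv0 (funext hall)
    refine finrank_le_one_of_pairings _ v hc₀ fun u hu j hj => ?_
    exact hP p q hpq u hu v hv c₀ j (Ne.symm hj)
  rw [hdim]
  exact sum_le_four_of_pairs (fun i => finrank K ((V i).map (ρ i))) hle hPL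

/-- **Subspaces along which `per_4` is affine have dimension `≤ 4`.** [folklore] -/
theorem finrank_le_four_of_affine [CharZero K] (W : Submodule K (Fin 4 × Fin 4 → K))
    (hW : ∀ (u : Fin 4 × Fin 4 → K), ∀ y ∈ W, ∃ e₀ e₁ : K, ∀ s : K,
      eval (u + s • y) (perPoly (Fin 4) K) = e₀ + s * e₁) :
    finrank K W ≤ 4 :=
  finrank_le_four_of_perm_two_blocks W (perm_two_blocks_of_affine W hW)

end Summit.ValiantsHypothesis.ValiantsHypothesis.Theorems.SymPencilPerFourBlocks

end
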